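import Literature.MathematicalPhysics.QuantumFieldTheory.Balaban1983to89.T4BetaReadOut
import Literature.MathematicalPhysics.QuantumFieldTheory.Balaban1983to89.T4CouplingAnalyticity
import Literature.MathematicalPhysics.QuantumFieldTheory.Balaban1983to89.T4TowerRateComposition
import Literature.Probability.RandomMatrixProducts.AndersonModel1DEstimates

/-!
# `Balaban1983to89.T4CurrencyMatching` — node U2's box-uniform coupling matching in ANY CURRENCY of the history moduli
(t = 1/g², g, log g), closed by a RATE-LOSS two-sided fixed point (memory rate < output rate; NO asymptotic-freedom lower
bound on the β-functions), and the CONSUMPTION of the t-form of NE9 that the analytic member of node U3 delivers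
(`T4CouplingAnalyticity.ne9T_of_dilationStep`) by BOTH consumers of NE9 — node U2 (via the read-out (R) of `T4BetaReadOut`)
and node U3 along the tower (`T4TowerRateComposition.uRateUpTo_tower`) — BY NAME
(cell `pub-balaban`, T4-DAG v18 §2 nodes U2/U3, §6 NE4/NE5/NE9; journal row T4-U3.E-NE9-PROVE-P1d*; lineage t4-ne9-p1 GEN 4;
typing + kernel-checked real-number bookkeeping only)

HONEST FRAMING (T4-DAG PAGE 1).  The cell's T4 target is rung (B)+1: existence AND uniqueness of the ε → 0 limit of
Bałaban's unit-scale averaged expectations on a FIXED finite torus — strictly beyond ultraviolet stability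
([Balaban1988Convergent] Cor. 3 p. 264; [Balaban1989LargeFieldII] Thm 1 p. 355), and NOT infinite volume, NOT a mass gap,
NOT the Clay problem.  This module ASSERTS NOTHING about Bałaban's functionals: every `def … : Prop` is a HYPOTHESIS SHAPE
over pv16's history β-functions (`FlowStep.HBeta`) or over the ABSTRACT carriers of `T4OutputRate` (binders, consumed by the
spine, never used as facts), and every `theorem` is kernel-checked real-number bookkeeping.  No β lower bound, no BetaPertH,
no (B)/(B^μ) occurs anywhere in this file (nothing conditional is hidden in a definition: the five definitions are two
coordinate functions, a re-parametrisation and two hypothesis shapes displayed in full).  Value = the answer to ONE located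
question of the lineage's record (`t4/T4-EST-NE9-P1.md` v1.6 §10, 10.6: "can node U2 consume the t-form / log-form of NE9 that
the analytic member's surviving hypothesis [H-dil] delivers, or is the g-form — wall W5, GAPS G-ne9p1-8 — load-bearing for
the edge U3 → U2?") made kernel: the t-form IS consumable, by both consumers, under a memory-rate gap; NOT summit progress,
and NOT a discharge of any wall of the analytic member ([H-dil], W2, W3, W4 stay exactly as located in v1.4's docstring).

WHAT IS PRINTED (nothing is newly quoted by this leaf; the quotations are certified in the headers of the imported tree
modules — `T4CouplingMatching` v1.2 (renders of [Balaban1987RG1] pp. 255–259, 298 read as images by `b2b-balaban-pv16`,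
GAPS C-pv10-23), `T4OutputRate` v1.1 (`t4/T4-XREAD-U3.md` §1), `T4BetaReadOut` (p. 264 (1.20)–(1.22)), `T4CouplingAnalyticity`
v1.4 (pp. 256–268, [Balaban1988RG2Cluster] (1.34), (2.15)–(2.17)); journal page = PDF page + 248 for CMP **109**):
* [Balaban1987RG1] (0.20) p. 256: the recursion `1/g_k² = 1/g²_{k+1} + β_{k+1}(g_k)` — its OWN variable is `t = 1/g²`
  (pv16 `T4CouplingMatching.disc gA gB j = |1/(g^A_j)² − 1/(g^B_{j+1})²|` is a t-discrepancy);
* p. 298: *"We write β_j as explicitly dependent on g_{j−1}, although it depends also on all preceding coupling constants."*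
  and p. 256 *"The function E_k depends also on the effective coupling constants g₀, …, g_{k−1}."* — the DEPENDENCE is
  printed, NO MODULUS of it is (cell NE9, GAPS G-t4-U2-2 / G-t4-U3-3);
* Thm 1 p. 259 / Thm 3 p. 264: everything is stated on the box *"0 < g_k ≤ γ"*, *"The constant γ depends on all other
  constants."* — the window of every statement below is that box (or its t-image `t ≥ γ⁻²`); Thm 2 p. 259: the
  renormalization condition `g_K = g` (the infrared pin of the runs, pv16 `disc_pin`).
NOT PRINTED anywhere in [Balaban1987RG1], [Balaban1988RG2Cluster], [Balaban1988Convergent] (cell GAPS G-t4-U2-1/2,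
G-t4-U3-1/3, this lineage's G-ne9p1-1…-8): the η-rate of β (NE4) or of the terms (NE5), any history modulus (NE9) in any
currency, the read-out constant `cr` of (R), and every analytic hypothesis of the analytic member ((AN-LAST-dil) = [H-dil],
(AN-OLD), (CONTR), the evaluation into the (0.25)-weighted carrier).  They are BINDERS below, displayed in full.

THE POINT.  The analytic member of node U3 (`T4CouplingAnalyticity` §6–§7) delivers NE9 for term families of the
t-HISTORY `(1/g₀², 1/g₁², …)` over the t-box `[t₀, ∞[` with geometric moduli (`ne9T_of_dilationStep`: Cauchy estimates on
the RELATIVE discs `|z − s| ≤ c·s` — the only disc shape the printed small-field domain (1.34) of [II] tolerates — give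
t-moduli `4M₁/(c·t₀)`, i.e. SMALL, `O(γ²)`, at `t₀ = γ⁻²`), equivalently log-moduli / RELATIVE coupling discrepancies
`|Δg|/g`.  The g-form over `Window γ` does NOT follow from hypotheses of that shape (kernel no-go
`T4CouplingAnalyticity.exists_couplingAnalyticRel_not_ne9Window`) and needs the extra, non-inspection-level input W5.  Node
U2's consumers in the tree are typed on the g-form: `T4BetaReadOut.histLipschitz_of_ne9` reads `HistLipschitz Λ γ β`
(moduli against `|p_i − q_i|`) and pv16's closure `T4CouplingMatching.twoSided_fixedPoint` / `disc_le_of_fadingMemory`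
converts `|g^A_i − g^B_{i+1}|` to the t-discrepancy with the POINTWISE weight `(g^A_i)²g^B_{i+1}`, whose SUM along the runs
must be bounded (`Σ ≤ U`): that is where the asymptotic-freedom lower bound `EventualLowerH b γ k₀ β` enters the box-uniform
chain (`injectedRate_of_runs_eventual`).  In the t-currency the weight is `1` — in the log-currency `γ²`, in the
g-currency `γ³/2` — a SUP bound, never summable along `K + 1` scales; the same-rate fixed point cannot close `K`-uniformly
with it.  The way out is the one `T4TwoRunMatching.twoPoint_fixedPoint` took for the two-run chain: let the memory
contract at a rate `ω` STRICTLY SMALLER than the output rate `ρ`; then `Σ_{i≤j} ω^{j−i}ρ^i ≤ ρ(ρ − ω)⁻¹ρ^j` and a sup-bounded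
weight suffices (`twoSided_fixedPoint_rateLoss`).  Consequences, all kernel: node U2's box-uniform matching in ANY currency
with ONE γ-type window and NO β lower bound (§3); pv16's g-chain without `EventualLowerH` (`injectedRate_of_runs_gap`);
the U3 → U2 liaison of `T4BetaReadOut` in any currency (§4); the t-form of NE9 END TO END from the [H-dil]-shape
hypotheses to node U2's output `T4CauchySum.InjectedRate` (§5, window `cr·4M₁γ²c⁻¹·ρ(ρ − μ)⁻¹ ≤ (1 − ρ)/2`, γ²-TYPE); and
the spine's own node-U3 bracket along the tower in the t-currency, where node U2's NATIVE output is the coupling rate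
with constant `Cd` instead of `γ³Cd` (§5b).  So on the analytic member W5 (G-ne9p1-8) is NOT load-bearing for either
consumer of NE9; what remains between the analytic member and NE9-as-consumed is exactly [H-dil] (G-ne9p1-6, -7, -6a) +
W2 (G-ne9p1-2, -5) + W3 (G-ne9p1-3) + W4 (G-ne9p1-4), unchanged, plus the memory-rate GAP `μ = ω₀ + 4M₂/ϱ < ρ < 1` (the
analytic member's (CONTR)/(AN-OLD) smallness, W3/W4's currency) in place of asymptotic freedom inside the matching.

## What is typed and proved

§1 CURRENCIES (over `FlowStep.HBeta`, the box `FlowStep.Box γ k = ]0,γ]^{k+1}`): `HistLipschitzBy φ Λ γ β` [HYPOTHESIS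
   SHAPE, NOT PRINTED] — history moduli against `|φ(p_i) − φ(q_i)|`; `histLipschitzBy_id_iff` (φ = id IS pv16's
   `HistLipschitz`, `Iff.rfl`); `invSq t = 1/g²`, `logT = log(1/g²) = −2 log g` (`logT_eq`), `HistLipschitzT` (t-currency);
   `CurrencyWeight φ γ w` [SHAPE] — the sup-weight dictionary `|φ(a) − φ(b)| ≤ w|1/a² − 1/b²|` on ]0,γ] — with the three
   instances `currencyWeight_invSq` (w = 1), `currencyWeight_id` (w = γ³/2, = `T4CouplingAnalyticity.abs_sub_le_of_window`),
   `currencyWeight_logT` (w = γ², the tree's log-Lipschitz lemma `Literature.Probability.RandomMatrixProducts.abs_log_sub_log_le`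
   above the floor γ⁻², imported by name) and `currencyWeight_log`
   (w = γ²/2); `histLipschitzT_of_by` (every currency converts to the t-currency with its sup weight),
   `histLipschitzT_of_histLipschitz` (g-form ⇒ t-form with `(γ³/2)Λ`; the converse direction is the one that fails).
§2 `twoSided_fixedPoint_rateLoss` — THE RATE-LOSS TWO-SIDED KERNEL: `δ ≥ 0`, `δ_K = 0`,
   `δ_j ≤ δ_{j+1} + cθ^j + C·Σ_{i≤j} ω^{j−i}u_iδ_i`, `0 ≤ u_i ≤ ū`, `0 ≤ θ ≤ ρ`, `0 ≤ ω < ρ < 1`, window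
   `Cūρ(ρ − ω)⁻¹ ≤ (1 − ρ)/2` ⇒ `δ_j ≤ 2c(1 − ρ)⁻¹ρ^j` (`j ≤ K`), constant free of `K` (`T4BetaMemory.geom_row_sum` + the
   diagonal, `T4CouplingMatching.backward_geom`, absorption at the maximiser of `δ_i/ρ^i`).
§3 NODE U2 IN THE CURRENCY φ: `disc_step_by` ((0.20) twice ⇒ `δ_j ≤ δ_{j+1} + cθ^j + Σ_{i≤j} Λ j i·w·δ_i`),
   `disc_le_of_fadingMemory_by` (+ `T4CouplingMatching.FadingMemory C ω Λ`, pin, rates, window `C·w·ρ(ρ − ω)⁻¹ ≤ (1 − ρ)/2`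
   ⇒ `disc ≤ 2c(1 − ρ)⁻¹ρ^j`, NO `EventualLowerH`), `injectedRate_of_runs_by` (family of IR-pinned runs ⇒
   `T4CauchySum.InjectedRate (2c/(1−ρ)) 0 ρ (fun K j ↦ disc (g K) (g (K+1)) j)` — verbatim the binder `hinj` of
   `T4TowerRateDischarge.uRateUpTo_of_nodes`, `Cd = 2c/(1−ρ)`, `θc = ρ`), `injectedRate_of_runs_gap` (pv16's g-currency
   chain with the memory gap instead of `EventualLowerH`; window `C(γ³/2)ρ(ρ − ω)⁻¹ ≤ (1 − ρ)/2`).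
§4 THE (R) LIAISON IN THE CURRENCY φ (over `T4OutputRate.Carriers`, `T4BetaReadOut`'s read-out shapes BY NAME):
   `reparam φ Eφ g = Eφ (φ ∘ g)` (a term family given as a function of the φ-history, re-parametrised by the couplings;
   pv05's `NE5`/`NE9`/`LipBackground` take the window as a parameter and are parametrisation-agnostic: `ne5_reparam`,
   `lipBackground_reparam`); `histLipschitzBy_of_ne9` (NE9 for `Eφ` over a φ-window `Wφ` ⊇ φ-images of the padded box
   histories + `RepresentsA (reparam φ Eφ) r γ β` + `ReadBounded r κ cr` ⇒ `HistLipschitzBy φ (cr·Λ (k+1) i) γ β`; the proof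
   of `T4BetaReadOut.histLipschitz_of_ne9` verbatim); `injectedRate_of_u3_by` (NE5 ∀ datum + NE9 for `EAφ` +
   `T4OutputRate.FadingMemory C₉ ω Λ` + (R) + `CurrencyWeight φ γ w` + runs/box/pin + `0 ≤ θ ≤ ρ`, `0 ≤ ω < ρ < 1` + the ONE
   window `cr·C₉·ω·w·ρ(ρ − ω)⁻¹ ≤ (1 − ρ)/2` ⇒ `InjectedRate (2·cr·C₅·θ/(1−ρ)) 0 ρ`; compare `T4BetaReadOut.injectedRate_of_u3`:
   the binders `0 < b`, `EventualLowerH b γ k₀ β` and the AF-weighted smallness are gone, the gap `ω < ρ` comes in).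
§5 THE t-FORM CONSUMED: `invSq_extd_mem_boxWindow` (t-images of box histories lie in `BoxWindow [t₀, ∞[`, `t₀ ≤ γ⁻²`),
   `injectedRate_of_ne9T` (NE9 for a t-parametrised family over the t-box + the U2-side binders ⇒ node U2's output, weight
   1, window `cr·C₉·ω·ρ(ρ − ω)⁻¹ ≤ (1 − ρ)/2`), `injectedRate_of_dilationStep` (END TO END: the hypotheses of
   `T4CouplingAnalyticity.ne9T_of_dilationStep` VERBATIM — [H-dil]-shape relative discs, (AN-OLD), (CONTR), scale 0,
   evaluation — + NE5 + (R) + runs/box/pin + `μ = ω₀ + 4M₂/ϱ < ρ < 1` + `cr·(4M₁/(c·t₀))·ρ(ρ − μ)⁻¹ ≤ (1 − ρ)/2` ⇒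
   `InjectedRate (2·cr·C₅·θ/(1−ρ)) 0 ρ (disc …)`; composition by name, no new content).  §5b `couplingRateT_of_injectedDisc`
   (node U2's native output IS the t-coupling rate, constant `Cd`), `uRateUpTo_towerT` (`T4TowerRateComposition.uRateUpTo_tower`
   instantiated on t-histories: `URateUpTo K` with constant `a + C₉·Cd·ω/(θ − ω) + C₅` — no `γ³`).
§6 NON-VACUITY (light): `shapes_const` (the constant family inhabits the shapes with zero moduli), `rateLoss_window_example`
   (the pure-source profile `c·Σ_{i∈[j,K)} ρ^i` meets every hypothesis of §2 and its bound up to the factor 2).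

RELATION TO THE OTHER LEAVES (by name; nothing re-typed).  pv16 `T4CouplingMatching` (same-rate fixed point, AF-summable
weights, `EventualLowerH`) and t4-ne4-p1 `T4BetaReadOut` / `T4FlagMemory[AF]` (g-currency read-out; `T4FlagMemoryAF`'s
coupling-weighted ONE-STEP memory is a different lever — it weakens the scheme's memory hypothesis, not the matching's
weight sum) are CONSUMED, not modified; t4-ne4-p2 `T4TwoRunMatching` / `T4TwoRunClosure` made the rate-gap trade for the
TWO-RUN chain — this leaf makes it for the BOX-UNIFORM chain and adds the currency dictionary; t4-ne7-p1
`T4TowerRateComposition.uRateUpTo_tower` is instantiated, not altered (its g-currency seam `couplingRate_pair_of_injectedDisc`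
is where `γ³` lives).  This lineage's `T4CouplingAnalyticity` v1.4 is imported for `ne9T_of_dilationStep`, `BoxWindow`,
`geomMod`, `abs_sub_le_of_window` only; P2's `T4HistoryLipschitz*` modules are not imported;
`Literature.Probability.RandomMatrixProducts.AndersonModel1DEstimates` is imported for its log-Lipschitz lemma only (gate
dedup: one lemma, one place).

ABSOLUTE RULE observed: no internally-minted statement enters as a cited fact; `[cite: …]` tags below name the printed
equation whose SHAPE a binder transcribes (never a printed estimate), `[folklore]` tags mark real-number bookkeeping.
-/

namespace Literature.MathematicalPhysics.QuantumFieldTheory.Balaban1983to89.T4CurrencyMatching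

open Literature.MathematicalPhysics.QuantumFieldTheory.Balaban1983to89
open Literature.MathematicalPhysics.QuantumFieldTheory.Balaban1983to89.FlowStep
open Literature.MathematicalPhysics.QuantumFieldTheory.Balaban1983to89.T4CouplingMatching
  (ScaleShiftRate HistLipschitz disc disc_nonneg disc_pin backward_geom prefixOf_mem_box tail_prefixOf)
open Literature.MathematicalPhysics.QuantumFieldTheory.Balaban1983to89.T4OutputRate (Carriers Functional Window NE5 NE9 LipBackground)
open Literature.MathematicalPhysics.QuantumFieldTheory.Balaban1983to89.T4FlagMemory (extd extd_coe extd_adm tail_mem_box)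
open Literature.MathematicalPhysics.QuantumFieldTheory.Balaban1983to89.T4BetaReadOut
  (ReadOut RepresentsA RepresentsB ReadBounded ReadCovariant SliceClose extd_mem_window scaleShiftRate_of_ne5
    fadingMemory_readOut fadingMemory_const_nonneg)
open Literature.MathematicalPhysics.QuantumFieldTheory.Balaban1983to89.T4CouplingAnalyticity (BoxWindow geomMod)
open Literature.MathematicalPhysics.QuantumFieldTheory.Balaban1983to89.T4TowerRateComposition (URateUpTo uRateUpTo_tower)
open Finset

/-! ## §1 Currencies of the history moduli and the sup-weight dictionary to the recursion variable t = 1/g² -/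

section Currency

/-- HYPOTHESIS SHAPE (node U2's history moduli IN THE CURRENCY `φ`; NOT PRINTED, cell NE4/NE9, GAPS G-t4-U2-2): on the box
]0,γ]^{k+1}, `|β_{k+1}(p) − β_{k+1}(q)| ≤ Σ_{i≤k} Λ k i · |φ(p_i) − φ(q_i)|`.  `φ = id` is VERBATIM pv16's
`T4CouplingMatching.HistLipschitz` (`histLipschitzBy_id_iff`); `φ = invSq` (t = 1/g², the variable of (0.20)) and
`φ = logT` (u = log t) are the currencies in which the analytic member of node U3 delivers NE9
(`T4CouplingAnalyticity.ne9T_of_dilationStep`, `ne9Log_of_couplingAnalyticRel`). [cite: Balaban1987RG1, §5 p.298 and (0.20) p.256] -/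
def HistLipschitzBy (φ : ℝ → ℝ) (Λ : ℕ → ℕ → ℝ) (γ : ℝ) (β : HBeta) : Prop :=
  ∀ k (p q : Fin (k + 1) → ℝ), p ∈ Box γ k → q ∈ Box γ k →
    |β k p - β k q| ≤ ∑ i : Fin (k + 1), Λ k i * |φ (p i) - φ (q i)|

/-- The g-currency is pv16's shape, definitionally. [folklore] -/
theorem histLipschitzBy_id_iff {Λ : ℕ → ℕ → ℝ} {γ : ℝ} {β : HBeta} :
    HistLipschitzBy id Λ γ β ↔ HistLipschitz Λ γ β := Iff.rfl

/-- The recursion's own variable `t = 1/g²` ((0.20): `1/g_k² = 1/g²_{k+1} + β_{k+1}`). [cite: Balaban1987RG1, (0.20) p.256] -/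
noncomputable def invSq (x : ℝ) : ℝ := (x ^ 2)⁻¹

/-- The log-currency `u = log t = log(1/g²) = −2 log g` (relative coupling discrepancies). [folklore] -/
noncomputable def logT (x : ℝ) : ℝ := Real.log ((x ^ 2)⁻¹)

/-- `logT g = −2 log g`. [folklore] -/
theorem logT_eq (x : ℝ) : logT x = -2 * Real.log x := by
  rw [logT, Real.log_inv, Real.log_pow]
  push_cast
  ring

/-- History moduli in the t-CURRENCY (the canonical one for node U2: the coupling discrepancy `T4CouplingMatching.disc` IS a
t-discrepancy). [cite: Balaban1987RG1, (0.20) p.256] -/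
abbrev HistLipschitzT (Λ : ℕ → ℕ → ℝ) (γ : ℝ) (β : HBeta) : Prop := HistLipschitzBy invSq Λ γ β

/-- THE SUP-WEIGHT DICTIONARY of a currency to the recursion variable on the box ]0,γ]:
`|φ(a) − φ(b)| ≤ w · |1/a² − 1/b²|` for `a, b ∈ ]0,γ]`, with ONE constant `w` (a sup over the box — contrast pv16's
pointwise weight `a²b` of `T4CouplingMatching.abs_sub_le_of_inv_sq`, summable only along asymptotically free runs). [folklore] -/
def CurrencyWeight (φ : ℝ → ℝ) (γ w : ℝ) : Prop :=
  ∀ a b : ℝ, 0 < a → a ≤ γ → 0 < b → b ≤ γ → |φ a - φ b| ≤ w * |(a ^ 2)⁻¹ - (b ^ 2)⁻¹|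

/-- t-currency: weight 1 (an equality). [folklore] -/
theorem currencyWeight_invSq (γ : ℝ) : CurrencyWeight invSq γ 1 := fun a b _ _ _ _ => by simp [invSq]

/-- g-currency: weight `γ³/2` (`T4CouplingAnalyticity.abs_sub_le_of_window`: `|a − b| ≤ (γ³/2)|1/a² − 1/b²|` on ]0,γ]).
[folklore] -/
theorem currencyWeight_id {γ : ℝ} : CurrencyWeight id γ (γ ^ 3 / 2) :=
  fun _ _ ha haγ hb hbγ => T4CouplingAnalyticity.abs_sub_le_of_window ha haγ hb hbγ

/-- log-currency `u = log(1/g²)`: weight `γ²` (`1/a², 1/b² ≥ 1/γ²` on the box; the tree's log-Lipschitz lemma above a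
positive floor, `Literature.Probability.RandomMatrixProducts.abs_log_sub_log_le`, imported BY NAME). [folklore] -/
theorem currencyWeight_logT {γ : ℝ} (hγ : 0 < γ) : CurrencyWeight logT γ (γ ^ 2) := by
  intro a b ha haγ hb hbγ
  have hm : 0 < (γ ^ 2)⁻¹ := by positivity
  have hxa : (γ ^ 2)⁻¹ ≤ (a ^ 2)⁻¹ := inv_anti₀ (pow_pos ha 2) (pow_le_pow_left₀ ha.le haγ 2)
  have hxb : (γ ^ 2)⁻¹ ≤ (b ^ 2)⁻¹ := inv_anti₀ (pow_pos hb 2) (pow_le_pow_left₀ hb.le hbγ 2)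
  have h := Literature.Probability.RandomMatrixProducts.abs_log_sub_log_le hm hxa hxb
  calc |logT a - logT b| = |Real.log (a ^ 2)⁻¹ - Real.log (b ^ 2)⁻¹| := rfl
    _ ≤ |(a ^ 2)⁻¹ - (b ^ 2)⁻¹| / (γ ^ 2)⁻¹ := h
    _ = γ ^ 2 * |(a ^ 2)⁻¹ - (b ^ 2)⁻¹| := by rw [div_inv_eq_mul, mul_comm]

/-- The plain log-coupling currency `log g`: weight `γ²/2`. [folklore] -/
theorem currencyWeight_log {γ : ℝ} (hγ : 0 < γ) : CurrencyWeight Real.log γ (γ ^ 2 / 2) := by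
  intro a b ha haγ hb hbγ
  have h := currencyWeight_logT hγ a b ha haγ hb hbγ
  rw [logT_eq, logT_eq, show -2 * Real.log a - -2 * Real.log b = -2 * (Real.log a - Real.log b) by ring,
    abs_mul, abs_neg, abs_two] at h
  have h0 : 0 ≤ γ ^ 2 * |(a ^ 2)⁻¹ - (b ^ 2)⁻¹| := by positivity
  calc |Real.log a - Real.log b| = (2 * |Real.log a - Real.log b|) / 2 := by ring
    _ ≤ (γ ^ 2 * |(a ^ 2)⁻¹ - (b ^ 2)⁻¹|) / 2 := by gcongr
    _ = γ ^ 2 / 2 * |(a ^ 2)⁻¹ - (b ^ 2)⁻¹| := by ring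

/-- **EVERY CURRENCY CONVERTS TO THE t-CURRENCY ON THE BOX** with its sup weight: `HistLipschitzBy φ Λ` + `CurrencyWeight φ γ w`
⇒ `HistLipschitzT (w·Λ)` (moduli `≥ 0`). [folklore] -/
theorem histLipschitzT_of_by {φ : ℝ → ℝ} {Λ : ℕ → ℕ → ℝ} {γ w : ℝ} {β : HBeta} (hL : HistLipschitzBy φ Λ γ β)
    (hφ : CurrencyWeight φ γ w) (hΛ : ∀ k i, i ≤ k → 0 ≤ Λ k i) :
    HistLipschitzT (fun k i => w * Λ k i) γ β := by
  intro k p q hp hq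
  refine (hL k p q hp hq).trans (Finset.sum_le_sum fun i _ => ?_)
  have hpi := (mem_box.mp hp) i
  have hqi := (mem_box.mp hq) i
  calc Λ k i * |φ (p i) - φ (q i)| ≤ Λ k i * (w * |(p i ^ 2)⁻¹ - (q i ^ 2)⁻¹|) :=
        mul_le_mul_of_nonneg_left (hφ _ _ hpi.1 hpi.2 hqi.1 hqi.2) (hΛ k i (Nat.le_of_lt_succ i.isLt))
    _ = w * Λ k i * |invSq (p i) - invSq (q i)| := by simp only [invSq]; ring

/-- In particular pv16's g-form gives the t-form with moduli `(γ³/2)·Λ`; the converse fails (the t-form is WEAKER: g-moduli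
recovered from t-moduli blow up like `(a + b)/(a²b²)` at the vertex — `T4CouplingAnalyticity` §9/§10). [folklore] -/
theorem histLipschitzT_of_histLipschitz {Λ : ℕ → ℕ → ℝ} {γ : ℝ} {β : HBeta} (hL : HistLipschitz Λ γ β)
    (hΛ : ∀ k i, i ≤ k → 0 ≤ Λ k i) : HistLipschitzT (fun k i => γ ^ 3 / 2 * Λ k i) γ β :=
  histLipschitzT_of_by (φ := id) hL currencyWeight_id hΛ

end Currency

/-! ## §2 The rate-loss two-sided fixed point (sup-bounded weights; memory rate ω < output rate ρ) -/

/-- **THE TWO-SIDED KERNEL WITH RATE LOSS.**  For rates `0 ≤ θ ≤ ρ`, `0 ≤ ω < ρ < 1` (`ρ > 0`), constants `c, C ≥ 0`, `δ ≥ 0`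
with `δ_K = 0`, weights `0 ≤ u_i ≤ ū` (`i ≤ K`; a SUP bound — no summability), the WINDOW `C·ū·ρ(ρ − ω)⁻¹ ≤ (1 − ρ)/2` and the
recursion `δ_j ≤ δ_{j+1} + cθ^j + C·Σ_{i≤j} ω^{j−i}u_iδ_i` (`j < K`), one has `δ_j ≤ 2c(1 − ρ)⁻¹ρ^j` for every `j ≤ K` —
constant independent of K.  Proof: with `M = max_{i≤K} δ_iρ^{−i}` the feedback is `≤ ūM·Σ_{i≤j}ω^{j−i}ρ^i ≤ ūMρ(ρ−ω)⁻¹ρ^j`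
(`T4BetaMemory.geom_row_sum` + the diagonal); `T4CouplingMatching.backward_geom` at rate ρ and absorption at the maximiser.
Twin of pv16's `T4CouplingMatching.twoSided_fixedPoint` (there ω = ρ = θ and the weights must be SUMMABLE — asymptotic
freedom; here the memory contracts strictly faster than the output decays and a sup bound suffices — the trade
`T4TwoRunMatching.twoPoint_fixedPoint` makes for the TWO-RUN chain, made for the BOX-UNIFORM chain; that two-point lemma
would give this one only under its gap `2ω < ρ`, via `s_j = Σ_{i≤j} ω^{j−i}u_iδ_i`, `C = 1`; the direct convolution needs
`ω < ρ` alone). [folklore] -/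
theorem twoSided_fixedPoint_rateLoss {K : ℕ} {δ u : ℕ → ℝ} {θ ω ρ c C ubar : ℝ}
    (hρ0 : 0 < ρ) (hρ1 : ρ < 1) (hθ0 : 0 ≤ θ) (hθρ : θ ≤ ρ) (hω0 : 0 ≤ ω) (hωρ : ω < ρ)
    (hc : 0 ≤ c) (hC : 0 ≤ C) (hδ : ∀ j, 0 ≤ δ j) (hu : ∀ i, i ≤ K → 0 ≤ u i ∧ u i ≤ ubar)
    (hsmall : C * ubar * (ρ / (ρ - ω)) ≤ (1 - ρ) / 2) (hK : δ K = 0)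
    (hrec : ∀ j, j < K →
      δ j ≤ δ (j + 1) + c * θ ^ j + C * ∑ i ∈ range (j + 1), ω ^ (j - i) * u i * δ i) :
    ∀ j, j ≤ K → δ j ≤ 2 * c / (1 - ρ) * ρ ^ j := by
  have hne : (range (K + 1)).Nonempty := ⟨0, by simp⟩
  set M := (range (K + 1)).sup' hne (fun i => δ i / ρ ^ i) with hM
  have hMi : ∀ i, i ≤ K → δ i ≤ M * ρ ^ i := by
    intro i hi
    have h : δ i / ρ ^ i ≤ M :=
      Finset.le_sup' (fun i => δ i / ρ ^ i) (Finset.mem_range.mpr (Nat.lt_succ_of_le hi))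
    rwa [div_le_iff₀ (pow_pos hρ0 i)] at h
  have hM0 : 0 ≤ M := by
    have h : δ 0 / ρ ^ 0 ≤ M :=
      Finset.le_sup' (fun i => δ i / ρ ^ i) (Finset.mem_range.mpr (Nat.succ_pos K))
    have : (0 : ℝ) ≤ δ 0 / ρ ^ 0 := by simpa using hδ 0
    exact this.trans h
  have hubar : 0 ≤ ubar := (hu 0 (Nat.zero_le K)).1.trans (hu 0 (Nat.zero_le K)).2
  have hρω : 0 < ρ - ω := sub_pos.mpr hωρ
  set A := C * ubar * (ρ / (ρ - ω)) with hA
  have hA0 : 0 ≤ A := by positivity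
  -- geometric convolution including the diagonal term
  have hconv : ∀ j, ∑ i ∈ range (j + 1), ω ^ (j - i) * ρ ^ i ≤ ρ / (ρ - ω) * ρ ^ j := by
    intro j
    rw [Finset.sum_range_succ, Nat.sub_self, pow_zero, one_mul]
    have h := T4BetaMemory.geom_row_sum hω0 hωρ j
    have key : ω / (ρ - ω) * ρ ^ j + ρ ^ j = ρ / (ρ - ω) * ρ ^ j := by
      field_simp
      ring
    linarith
  have hrec' : ∀ j, j < K → δ j ≤ δ (j + 1) + (c + A * M) * ρ ^ j := by
    intro j hj
    have hsum : ∑ i ∈ range (j + 1), ω ^ (j - i) * u i * δ i ≤ ubar * M * (ρ / (ρ - ω) * ρ ^ j) := by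
      calc ∑ i ∈ range (j + 1), ω ^ (j - i) * u i * δ i
          ≤ ∑ i ∈ range (j + 1), ω ^ (j - i) * ubar * (M * ρ ^ i) := by
            refine Finset.sum_le_sum fun i hi => ?_
            have hi' : i ≤ K := by have := mem_range.mp hi; omega
            have hω' : 0 ≤ ω ^ (j - i) := pow_nonneg hω0 _
            calc ω ^ (j - i) * u i * δ i ≤ ω ^ (j - i) * ubar * δ i :=
                  mul_le_mul_of_nonneg_right (mul_le_mul_of_nonneg_left (hu i hi').2 hω') (hδ i)
              _ ≤ ω ^ (j - i) * ubar * (M * ρ ^ i) :=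
                  mul_le_mul_of_nonneg_left (hMi i hi') (mul_nonneg hω' hubar)
        _ = ubar * M * ∑ i ∈ range (j + 1), ω ^ (j - i) * ρ ^ i := by
            rw [Finset.mul_sum]
            exact Finset.sum_congr rfl fun i _ => by ring
        _ ≤ ubar * M * (ρ / (ρ - ω) * ρ ^ j) :=
            mul_le_mul_of_nonneg_left (hconv j) (mul_nonneg hubar hM0)
    have hθj : c * θ ^ j ≤ c * ρ ^ j := mul_le_mul_of_nonneg_left (pow_le_pow_left₀ hθ0 hθρ j) hc
    have h1 := hrec j hj
    have h2 : C * ∑ i ∈ range (j + 1), ω ^ (j - i) * u i * δ i ≤ A * M * ρ ^ j := by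
      calc C * ∑ i ∈ range (j + 1), ω ^ (j - i) * u i * δ i ≤ C * (ubar * M * (ρ / (ρ - ω) * ρ ^ j)) :=
            mul_le_mul_of_nonneg_left hsum hC
        _ = A * M * ρ ^ j := by rw [hA]; ring
    have e : (c + A * M) * ρ ^ j = c * ρ ^ j + A * M * ρ ^ j := by ring
    linarith [h1, h2, hθj, e]
  have hs : 0 ≤ c + A * M := by positivity
  have hb := backward_geom hρ0.le hρ1 hs (le_of_eq hK) hrec'
  obtain ⟨i₀, hi₀, hMi₀⟩ := Finset.exists_mem_eq_sup' hne (fun i => δ i / ρ ^ i)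
  have hi₀K : i₀ ≤ K := Nat.lt_succ_iff.mp (Finset.mem_range.mp hi₀)
  have h1ρ : 0 < 1 - ρ := by linarith
  have hMle : M ≤ (c + A * M) / (1 - ρ) := by
    calc M = δ i₀ / ρ ^ i₀ := hMi₀
      _ ≤ (c + A * M) / (1 - ρ) := by
          rw [div_le_iff₀ (pow_pos hρ0 i₀)]
          exact hb i₀ hi₀K
  have hMle' : M * (1 - ρ) ≤ c + A * M := (le_div_iff₀ h1ρ).mp hMle
  have hAM : A * M ≤ (1 - ρ) / 2 * M := mul_le_mul_of_nonneg_right hsmall hM0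
  have hMfin : M ≤ 2 * c / (1 - ρ) := by
    rw [le_div_iff₀ h1ρ]
    nlinarith [hMle', hAM]
  intro j hj
  calc δ j ≤ M * ρ ^ j := hMi j hj
    _ ≤ 2 * c / (1 - ρ) * ρ ^ j := mul_le_mul_of_nonneg_right hMfin (pow_nonneg hρ0.le _)

/-! ## §3 Node U2's coupling matching in the currency φ (memory gap, one window, NO β lower bound) -/

/-- THE BACKWARD COUPLING-MATCHING RECURSION IN THE CURRENCY φ: for `j < K`,
`δ_j ≤ δ_{j+1} + cθ^j + Σ_{i≤j} Λ j i · w · δ_i` (`δ = disc gA gB`) — pv16's `T4CouplingMatching.disc_step` with the history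
shift measured in the currency φ (`HistLipschitzBy φ`) and converted by the sup weight `w` (`CurrencyWeight φ γ w`) instead of
the pointwise weight `(g^A_i)²g^B_{i+1}`.  Hypotheses, never facts: (0.20) for both runs, couplings in ]0,γ], the shapes.
[cite: Balaban1987RG1, (0.20) p.256] -/
theorem disc_step_by {β : HBeta} {φ : ℝ → ℝ} {γ c θ w : ℝ} {Λ : ℕ → ℕ → ℝ} {K : ℕ} {gA gB : ℕ → ℝ}
    (hA : RGEqH K β gA) (hB : RGEqH (K + 1) β gB)
    (hAbox : ∀ i, i ≤ K → 0 < gA i ∧ gA i ≤ γ) (hBbox : ∀ i, i ≤ K + 1 → 0 < gB i ∧ gB i ≤ γ)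
    (hS : ScaleShiftRate c θ γ β) (hL : HistLipschitzBy φ Λ γ β) (hΛ : ∀ k i, i ≤ k → 0 ≤ Λ k i)
    (hφ : CurrencyWeight φ γ w) {j : ℕ} (hj : j < K) :
    disc gA gB j ≤ disc gA gB (j + 1) + c * θ ^ j + ∑ i ∈ range (j + 1), Λ j i * w * disc gA gB i := by
  have eA := hA j hj
  have eB := hB (j + 1) (by omega)
  have hwbox : prefixOf gB (j + 1) ∈ Box γ (j + 1) := prefixOf_mem_box (by omega) hBbox
  have hpA : prefixOf gA j ∈ Box γ j := prefixOf_mem_box hj.le hAbox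
  have htail : Fin.tail (prefixOf gB (j + 1)) ∈ Box γ j := by
    rw [tail_prefixOf]
    exact prefixOf_mem_box (N := K) hj.le fun i hi => hBbox (i + 1) (by omega)
  have h1 := hS j (prefixOf gB (j + 1)) hwbox
  have h2 := hL j (Fin.tail (prefixOf gB (j + 1))) (prefixOf gA j) htail hpA
  have h3 : ∑ i : Fin (j + 1), Λ j i * |φ (Fin.tail (prefixOf gB (j + 1)) i) - φ (prefixOf gA j i)|
      ≤ ∑ i ∈ range (j + 1), Λ j i * w * disc gA gB i := by
    rw [Finset.sum_range (fun i => Λ j i * w * disc gA gB i)]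
    refine Finset.sum_le_sum fun i _ => ?_
    have hiK : (i : ℕ) ≤ K := by have := i.isLt; omega
    have hgA := hAbox i hiK
    have hgB := hBbox (i + 1) (by omega)
    simp only [Fin.tail, prefixOf_apply, Fin.val_succ]
    have hcw := hφ (gB (i + 1)) (gA i) hgB.1 hgB.2 hgA.1 hgA.2
    have hd : |(gB ((i : ℕ) + 1) ^ 2)⁻¹ - (gA i ^ 2)⁻¹| = disc gA gB i := by
      rw [disc, one_div, one_div, abs_sub_comm]
    rw [hd] at hcw
    calc Λ j i * |φ (gB (i + 1)) - φ (gA i)| ≤ Λ j i * (w * disc gA gB i) :=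
          mul_le_mul_of_nonneg_left hcw (hΛ j i (Nat.le_of_lt_succ i.isLt))
      _ = Λ j i * w * disc gA gB i := by ring
  have key : 1 / gA j ^ 2 - 1 / gB (j + 1) ^ 2
      = (1 / gA (j + 1) ^ 2 - 1 / gB (j + 1 + 1) ^ 2)
        + (β j (prefixOf gA j) - β j (Fin.tail (prefixOf gB (j + 1))))
        - (β (j + 1) (prefixOf gB (j + 1)) - β j (Fin.tail (prefixOf gB (j + 1)))) := by
    rw [eA, eB]
    ring
  have habs : disc gA gB j ≤ disc gA gB (j + 1)
      + |β j (prefixOf gA j) - β j (Fin.tail (prefixOf gB (j + 1)))|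
      + |β (j + 1) (prefixOf gB (j + 1)) - β j (Fin.tail (prefixOf gB (j + 1)))| := by
    simp only [disc]
    rw [key]
    exact (abs_sub _ _).trans (add_le_add (abs_add_le _ _) le_rfl)
  have hcomm : |β j (prefixOf gA j) - β j (Fin.tail (prefixOf gB (j + 1)))|
      = |β j (Fin.tail (prefixOf gB (j + 1))) - β j (prefixOf gA j)| := abs_sub_comm _ _
  linarith [habs, hcomm, h1, h2, h3]

/-- **NODE U2 IN THE CURRENCY φ (memory gap; K-UNIFORM; NO β LOWER BOUND).**  Two runs of (0.20) with the same history family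
`β` — A: K steps, B: K + 1 steps — in the box ]0,γ], pinned `g^A_K = g^B_{K+1}`; NE4 as `ScaleShiftRate c θ γ β`; history moduli
`HistLipschitzBy φ Λ γ β` with `FadingMemory C ω Λ`; the currency's sup weight `w`; rates `0 ≤ θ ≤ ρ`, `0 ≤ ω < ρ < 1`; the ONE
window `C·w·ρ(ρ − ω)⁻¹ ≤ (1 − ρ)/2`.  THEN `|1/(g^A_j)² − 1/(g^B_{j+1})²| ≤ 2c(1 − ρ)⁻¹ρ^j` for every `j ≤ K`.  Compared with
pv16's `T4CouplingMatching.disc_le_of_fadingMemory`: NO weight sum `Σ(g^A_i)²g^B_{i+1} ≤ U`, hence NO (eventual) lower bound on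
β / asymptotic freedom inside the matching; the price is the strict memory gap `ω < ρ` and the output rate ρ instead of θ.
Every hypothesis on `β` is an UNPRINTED input (cell NE4; GAPS G-t4-U2-1, G-t4-U2-2). Bookkeeping (`disc_step_by` +
`twoSided_fixedPoint_rateLoss`). [cite: Balaban1987RG1, (0.20) p.256 and §5 p.298] -/
theorem disc_le_of_fadingMemory_by {β : HBeta} {φ : ℝ → ℝ} {γ c θ ω ρ C w : ℝ} {Λ : ℕ → ℕ → ℝ} {K : ℕ}
    {gA gB : ℕ → ℝ} (hρ0 : 0 < ρ) (hρ1 : ρ < 1) (hθ0 : 0 ≤ θ) (hθρ : θ ≤ ρ) (hω0 : 0 ≤ ω) (hωρ : ω < ρ)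
    (hc : 0 ≤ c) (hC : 0 ≤ C) (hw : 0 ≤ w)
    (hA : RGEqH K β gA) (hB : RGEqH (K + 1) β gB)
    (hAbox : ∀ i, i ≤ K → 0 < gA i ∧ gA i ≤ γ) (hBbox : ∀ i, i ≤ K + 1 → 0 < gB i ∧ gB i ≤ γ)
    (hpin : gA K = gB (K + 1))
    (hS : ScaleShiftRate c θ γ β) (hL : HistLipschitzBy φ Λ γ β) (hΛ : T4CouplingMatching.FadingMemory C ω Λ)
    (hφ : CurrencyWeight φ γ w) (hsmall : C * w * (ρ / (ρ - ω)) ≤ (1 - ρ) / 2) :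
    ∀ j, j ≤ K → disc gA gB j ≤ 2 * c / (1 - ρ) * ρ ^ j := by
  refine twoSided_fixedPoint_rateLoss (u := fun _ => w) (ubar := w) hρ0 hρ1 hθ0 hθρ hω0 hωρ hc hC
    (disc_nonneg gA gB) (fun _ _ => ⟨hw, le_rfl⟩) hsmall (disc_pin hpin) ?_
  intro j hj
  have hstep := disc_step_by hA hB hAbox hBbox hS hL (fun k i hik => (hΛ k i hik).1) hφ hj
  have hsum : ∑ i ∈ range (j + 1), Λ j i * w * disc gA gB i
      ≤ C * ∑ i ∈ range (j + 1), ω ^ (j - i) * w * disc gA gB i := by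
    rw [Finset.mul_sum]
    refine Finset.sum_le_sum fun i hi => ?_
    have hij : i ≤ j := Nat.lt_succ_iff.mp (mem_range.mp hi)
    have hnn : 0 ≤ w * disc gA gB i := mul_nonneg hw (disc_nonneg _ _ _)
    calc Λ j i * w * disc gA gB i = Λ j i * (w * disc gA gB i) := by ring
      _ ≤ C * ω ^ (j - i) * (w * disc gA gB i) := mul_le_mul_of_nonneg_right (hΛ j i hij).2 hnn
      _ = C * (ω ^ (j - i) * w * disc gA gB i) := by ring
  linarith [hstep, hsum]

/-- **NODE U2 IN THE SPINE'S SHAPE, CURRENCY φ (kernel).**  For a family of IR-pinned runs `g K` of (0.20) in the box (run K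
against run K + 1 for every K), the hypotheses of `disc_le_of_fadingMemory_by` give
`T4CauchySum.InjectedRate (2c/(1−ρ)) 0 ρ (fun K j ↦ disc (g K) (g (K+1)) j)` — verbatim the binder `hinj` of
`T4TowerRateDischarge.uRateUpTo_of_nodes` (`Cd = 2c/(1−ρ)`, `θc = ρ`).  Bookkeeping over UNPRINTED inputs; nothing of
[Balaban1987RG1] is asserted. [cite: Balaban1987RG1, (0.20) p.256 and Thm 2 p.259] -/
theorem injectedRate_of_runs_by {β : HBeta} {φ : ℝ → ℝ} {γ c θ ω ρ C w : ℝ} {Λ : ℕ → ℕ → ℝ} (g : ℕ → ℕ → ℝ)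
    (gIR : ℝ) (hρ0 : 0 < ρ) (hρ1 : ρ < 1) (hθ0 : 0 ≤ θ) (hθρ : θ ≤ ρ) (hω0 : 0 ≤ ω) (hωρ : ω < ρ)
    (hc : 0 ≤ c) (hC : 0 ≤ C) (hw : 0 ≤ w)
    (hrun : ∀ K, RGEqH K β (g K)) (hbox : ∀ K i, i ≤ K → 0 < g K i ∧ g K i ≤ γ) (hpin : ∀ K, g K K = gIR)
    (hS : ScaleShiftRate c θ γ β) (hL : HistLipschitzBy φ Λ γ β) (hΛ : T4CouplingMatching.FadingMemory C ω Λ)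
    (hφ : CurrencyWeight φ γ w) (hsmall : C * w * (ρ / (ρ - ω)) ≤ (1 - ρ) / 2) :
    T4CauchySum.InjectedRate (2 * c / (1 - ρ)) 0 ρ (fun K j => disc (g K) (g (K + 1)) j) := by
  intro K j hj
  refine ⟨disc_nonneg _ _ _, ?_⟩
  have h := disc_le_of_fadingMemory_by hρ0 hρ1 hθ0 hθρ hω0 hωρ hc hC hw (hrun K) (hrun (K + 1)) (hbox K)
    (hbox (K + 1)) ((hpin K).trans (hpin (K + 1)).symm) hS hL hΛ hφ hsmall j hj
  simpa using h

/-- **pv16's g-CURRENCY CHAIN WITHOUT THE β LOWER BOUND (kernel).**  `ScaleShiftRate c θ γ β` + `HistLipschitz Λ γ β` +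
`FadingMemory C ω Λ` + runs/box/pin + `0 ≤ θ ≤ ρ`, `0 ≤ ω < ρ < 1` + the window `C·(γ³/2)·ρ(ρ − ω)⁻¹ ≤ (1 − ρ)/2` ⇒
`InjectedRate (2c/(1−ρ)) 0 ρ`.  Compare `T4CouplingMatching.injectedRate_of_runs_eventual` (same rate for memory and output,
`EventualLowerH b γ k₀ β` and `C((k₀+1)γ³ + 2γ/b) ≤ (1−θ)/2`): the eventual lower bound is traded for the memory gap.
[cite: Balaban1987RG1, (0.20) p.256 and Thm 2 p.259] -/
theorem injectedRate_of_runs_gap {β : HBeta} {γ c θ ω ρ C : ℝ} {Λ : ℕ → ℕ → ℝ} (g : ℕ → ℕ → ℝ) (gIR : ℝ)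
    (hρ0 : 0 < ρ) (hρ1 : ρ < 1) (hθ0 : 0 ≤ θ) (hθρ : θ ≤ ρ) (hω0 : 0 ≤ ω) (hωρ : ω < ρ) (hc : 0 ≤ c) (hC : 0 ≤ C)
    (hγ : 0 ≤ γ) (hrun : ∀ K, RGEqH K β (g K)) (hbox : ∀ K i, i ≤ K → 0 < g K i ∧ g K i ≤ γ)
    (hpin : ∀ K, g K K = gIR) (hS : ScaleShiftRate c θ γ β) (hL : HistLipschitz Λ γ β)
    (hΛ : T4CouplingMatching.FadingMemory C ω Λ) (hsmall : C * (γ ^ 3 / 2) * (ρ / (ρ - ω)) ≤ (1 - ρ) / 2) :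
    T4CauchySum.InjectedRate (2 * c / (1 - ρ)) 0 ρ (fun K j => disc (g K) (g (K + 1)) j) :=
  injectedRate_of_runs_by (φ := id) g gIR hρ0 hρ1 hθ0 hθρ hω0 hωρ hc hC (by positivity) hrun hbox hpin hS
    (histLipschitzBy_id_iff.mpr hL) hΛ currencyWeight_id hsmall

/-! ## §4 The (R) read-out in the currency φ: node U2's inputs and output from node U3's shapes -/

section Liaison

variable {C : Carriers}

/-- A term family GIVEN AS A FUNCTION OF THE φ-HISTORY (`Eφ (φ(g₀), φ(g₁), …)`), re-parametrised by the couplings: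
`reparam φ Eφ g = Eφ (φ ∘ g)`.  (The analytic member delivers NE9 for functionals of the t-history, `T4CouplingAnalyticity`
§1b/§6/§7; pv05's shapes `NE9`/`NE5` take the window as a parameter and are parametrisation-agnostic.) [folklore] -/
def reparam (φ : ℝ → ℝ) {Bg : Type} (Eφ : Functional C Bg) : Functional C Bg := fun g U X => Eφ (fun m => φ (g m)) U X

/-- Unfolding of `reparam`. [folklore] -/
@[simp] theorem reparam_apply (φ : ℝ → ℝ) {Bg : Type} (Eφ : Functional C Bg) (g : ℕ → ℝ) (U : Bg) (X : C.Dom) :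
    reparam φ Eφ g U X = Eφ (fun m => φ (g m)) U X := rfl

/-- NE5 is pointwise in the history, hence parametrisation-agnostic: NE5 for φ-parametrised families over `Wφ` gives NE5
for the re-parametrised families over any g-window mapped into `Wφ`. [folklore] -/
theorem ne5_reparam {φ : ℝ → ℝ} {W Wφ : Set (ℕ → ℝ)} {EAφ : Functional C C.BgA} {EBφ : Functional C C.BgB}
    {κ θ C₅ : ℝ} (hW : ∀ g ∈ W, (fun m => φ (g m)) ∈ Wφ) (h5 : NE5 EAφ EBφ Wφ κ θ C₅) :
    NE5 (reparam φ EAφ) (reparam φ EBφ) W κ θ C₅ :=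
  fun g hg U X => h5 _ (hW g hg) U X

/-- Lipschitz-in-the-background is parametrisation-agnostic in the same way (constant family re-parametrised). [folklore] -/
theorem lipBackground_reparam {φ : ℝ → ℝ} {W Wφ : Set (ℕ → ℝ)} {EAφ : Functional C C.BgA} {κ : ℝ}
    {CU : (ℕ → ℝ) → ℕ → ℝ} (hW : ∀ g ∈ W, (fun m => φ (g m)) ∈ Wφ) (hU : LipBackground EAφ Wφ κ CU) :
    LipBackground (reparam φ EAφ) W κ (fun g => CU (fun m => φ (g m))) :=
  fun g hg U U' X => hU _ (hW g hg) U U' X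

/-- **HISTORY MODULI OF β IN THE CURRENCY φ FROM NE9 OF THE φ-PARAMETRISED TERM FAMILY (kernel).**  NE9 for `Eφ` over a
φ-window `Wφ` containing the φ-images of the padded box histories, the read-out (R) of β from `reparam φ Eφ`
(`RepresentsA`) and `ReadBounded r κ cr` give `HistLipschitzBy φ (fun k i ↦ cr·Λ (k+1) i) γ β`.  The proof of
`T4BetaReadOut.histLipschitz_of_ne9` verbatim with `|φ(p_i) − φ(q_i)|` in place of `|p_i − q_i|`.  Bookkeeping over UNPRINTED
inputs. [folklore] -/
theorem histLipschitzBy_of_ne9 {Bg : Type} {φ : ℝ → ℝ} {Wφ : Set (ℕ → ℝ)} {Eφ : Functional C Bg} {r : ReadOut C Bg}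
    {β : HBeta} {γ κ cr : ℝ} {Λ : ℕ → ℕ → ℝ}
    (hW : ∀ k (v : Fin (k + 1) → ℝ), v ∈ Box γ k → (fun m => φ (extd v m)) ∈ Wφ)
    (h9 : NE9 Eφ Wφ κ Λ) (hA : RepresentsA (reparam φ Eφ) r γ β) (hr : ReadBounded r κ cr) :
    HistLipschitzBy φ (fun k i => cr * Λ (k + 1) i) γ β := by
  intro k p q hp hq
  set S : ℝ := ∑ i : Fin (k + 1), Λ (k + 1) i * |φ (p i) - φ (q i)| with hS
  have hclose : SliceClose κ k (reparam φ Eφ (extd p)) (reparam φ Eφ (extd q)) S := by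
    intro U X hX
    have h := h9 _ (hW k p hp) _ (hW k q hq) U X
    rw [hX] at h
    have hsum : ∑ i ∈ Finset.range (k + 1), Λ (k + 1) i * |φ (extd p i) - φ (extd q i)| = S := by
      rw [hS, ← Fin.sum_univ_eq_sum_range (fun i => Λ (k + 1) i * |φ (extd p i) - φ (extd q i)|) (k + 1)]
      simp only [extd_coe]
    rw [hsum, mul_comm] at h
    exact h
  have hread := hr k _ _ S hclose
  calc |β k p - β k q| = |r k (reparam φ Eφ (extd p)) - r k (reparam φ Eφ (extd q))| := by
        rw [hA k p hp, hA k q hq]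
    _ ≤ cr * S := hread
    _ = ∑ i : Fin (k + 1), cr * Λ (k + 1) i * |φ (p i) - φ (q i)| := by
        rw [hS, Finset.mul_sum]
        refine Finset.sum_congr rfl fun i _ => ?_
        ring

/-- **NODE U2'S OUTPUT FROM NODE U3 + (R) IN THE CURRENCY φ (kernel).**  NE5 (every datum of run B's unpaired first coupling),
NE9 for the φ-parametrised run-A family over `Wφ` with `FadingMemory C₉ ω Λ`, the two read-outs with `ReadBounded` /
`ReadCovariant`, the currency's sup weight `w`, a family of IR-pinned runs of (0.20) in the box, the rates `0 ≤ θ ≤ ρ`,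
`0 ≤ ω < ρ < 1` and the ONE window `cr·C₉·ω·w·ρ(ρ − ω)⁻¹ ≤ (1 − ρ)/2` give
`T4CauchySum.InjectedRate (2·cr·C₅·θ/(1−ρ)) 0 ρ (fun K j ↦ disc (g K) (g (K+1)) j)`.  Compared with
`T4BetaReadOut.injectedRate_of_u3`: the binders `0 < b`, `EventualLowerH b γ k₀ β` and the AF-weighted smallness are GONE;
the memory gap `ω < ρ` and the currency weight come in.  Every hypothesis UNPRINTED or conditional (cell NE5/NE9/(R); the
runs are node U1/H3's); nothing of [Balaban1987RG1] is asserted. [cite: Balaban1987RG1, (0.20) p.256 and Thm 3 p.264] -/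
theorem injectedRate_of_u3_by {φ : ℝ → ℝ} {W Wφ : Set (ℕ → ℝ)} {EAφ : Functional C C.BgA}
    {EB : ℝ → Functional C C.BgB} {rA : ReadOut C C.BgA} {rB : ReadOut C C.BgB} {β : HBeta}
    {γ κ θ C₅ C₉ ω cr ρ w : ℝ} {Λ : ℕ → ℕ → ℝ} (g : ℕ → ℕ → ℝ) (gIR : ℝ)
    (hW : ∀ k (v : Fin (k + 1) → ℝ), v ∈ Box γ k → extd v ∈ W)
    (hWφ : ∀ k (v : Fin (k + 1) → ℝ), v ∈ Box γ k → (fun m => φ (extd v m)) ∈ Wφ)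
    (h5 : ∀ b, 0 < b → b ≤ γ → NE5 (reparam φ EAφ) (EB b) W κ θ C₅) (h9 : NE9 EAφ Wφ κ Λ)
    (hΛ : T4OutputRate.FadingMemory C₉ ω Λ)
    (hA : RepresentsA (reparam φ EAφ) rA γ β) (hB : RepresentsB EB rB γ β) (hr : ReadBounded rA κ cr)
    (hcov : ReadCovariant rA rB κ cr) (hcr : 0 ≤ cr) (hC₅ : 0 ≤ C₅) (hθ : 0 ≤ θ) (hω : 0 ≤ ω) (hρ0 : 0 < ρ)
    (hθρ : θ ≤ ρ) (hωρ : ω < ρ) (hρ1 : ρ < 1) (hφ : CurrencyWeight φ γ w) (hw : 0 ≤ w)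
    (hrun : ∀ K, RGEqH K β (g K)) (hbox : ∀ K i, i ≤ K → 0 < g K i ∧ g K i ≤ γ) (hpin : ∀ K, g K K = gIR)
    (hsmall : cr * C₉ * ω * w * (ρ / (ρ - ω)) ≤ (1 - ρ) / 2) :
    T4CauchySum.InjectedRate (2 * (cr * C₅ * θ) / (1 - ρ)) 0 ρ (fun K j => disc (g K) (g (K + 1)) j) := by
  have hS : ScaleShiftRate (cr * C₅ * θ) θ γ β := scaleShiftRate_of_ne5 hW h5 hA hB hcov
  have hL : HistLipschitzBy φ (fun k i => cr * Λ (k + 1) i) γ β := histLipschitzBy_of_ne9 hWφ h9 hA hr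
  have hM : T4CouplingMatching.FadingMemory (cr * C₉ * ω) ω (fun k i => cr * Λ (k + 1) i) :=
    fadingMemory_readOut hΛ hcr
  have hC₉ : 0 ≤ C₉ := fadingMemory_const_nonneg hΛ
  exact injectedRate_of_runs_by g gIR hρ0 hρ1 hθ hθρ hω hωρ (by positivity) (by positivity) hw hrun hbox hpin hS
    hL hM hφ hsmall

/-! ## §5 The analytic member of node U3, consumed: the t-form of NE9 ⇒ node U2's output (no W5) -/

/-- The t-images of the padded box histories lie in the t-box `[t₀, ∞[` for every `t₀ ≤ γ⁻²`. [folklore] -/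
theorem invSq_extd_mem_boxWindow {γ t₀ : ℝ} (ht₀ : t₀ ≤ (γ ^ 2)⁻¹) {k : ℕ} {v : Fin (k + 1) → ℝ}
    (hv : v ∈ Box γ k) : (fun m => invSq (extd v m)) ∈ BoxWindow (Set.Ici t₀) := by
  refine T4CouplingAnalyticity.mem_boxWindow.mpr fun m => ?_
  have hadm := extd_adm hv m
  exact Set.mem_Ici.mpr (ht₀.trans (inv_anti₀ (pow_pos hadm.1 2) (pow_le_pow_left₀ hadm.1.le hadm.2 2)))

/-- **THE t-FORM OF NE9 IS CONSUMABLE (kernel).**  NE9 for a term family `Et` of the t-HISTORY over the t-box `[t₀, ∞[`,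
`t₀ ≤ γ⁻²` — the currency of the analytic member's surviving hypothesis (dilation radii, `T4CouplingAnalyticity` §6–§7) —
with `FadingMemory C₉ ω Λ`, NE5, the read-outs and a family of IR-pinned runs give node U2's output
`T4CauchySum.InjectedRate (2·cr·C₅·θ/(1−ρ)) 0 ρ` under the memory gap `ω < ρ < 1` and the window
`cr·C₉·ω·ρ(ρ − ω)⁻¹ ≤ (1 − ρ)/2` (weight 1).  With the analytic member's moduli (`C₉ω = 4M₁/(c·t₀) = 4M₁γ²/c` at `t₀ = γ⁻²`,
`injectedRate_of_dilationStep`) this is a γ²-TYPE window; NO g-form of NE9, NO weighted complex bound (wall W5, GAPS G-ne9p1-8),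
NO `EventualLowerH`.  Every hypothesis UNPRINTED or conditional. [cite: Balaban1987RG1, (0.20) p.256 and Thm 3 p.264] -/
theorem injectedRate_of_ne9T {W : Set (ℕ → ℝ)} {Et : Functional C C.BgA} {EB : ℝ → Functional C C.BgB}
    {rA : ReadOut C C.BgA} {rB : ReadOut C C.BgB} {β : HBeta} {γ t₀ κ θ C₅ C₉ ω cr ρ : ℝ} {Λ : ℕ → ℕ → ℝ}
    (g : ℕ → ℕ → ℝ) (gIR : ℝ)
    (hW : ∀ k (v : Fin (k + 1) → ℝ), v ∈ Box γ k → extd v ∈ W) (ht₀ : t₀ ≤ (γ ^ 2)⁻¹)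
    (h5 : ∀ b, 0 < b → b ≤ γ → NE5 (reparam invSq Et) (EB b) W κ θ C₅)
    (h9 : NE9 Et (BoxWindow (Set.Ici t₀)) κ Λ) (hΛ : T4OutputRate.FadingMemory C₉ ω Λ)
    (hA : RepresentsA (reparam invSq Et) rA γ β) (hB : RepresentsB EB rB γ β) (hr : ReadBounded rA κ cr)
    (hcov : ReadCovariant rA rB κ cr) (hcr : 0 ≤ cr) (hC₅ : 0 ≤ C₅) (hθ : 0 ≤ θ) (hω : 0 ≤ ω) (hρ0 : 0 < ρ)
    (hθρ : θ ≤ ρ) (hωρ : ω < ρ) (hρ1 : ρ < 1)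
    (hrun : ∀ K, RGEqH K β (g K)) (hbox : ∀ K i, i ≤ K → 0 < g K i ∧ g K i ≤ γ) (hpin : ∀ K, g K K = gIR)
    (hsmall : cr * C₉ * ω * (ρ / (ρ - ω)) ≤ (1 - ρ) / 2) :
    T4CauchySum.InjectedRate (2 * (cr * C₅ * θ) / (1 - ρ)) 0 ρ (fun K j => disc (g K) (g (K + 1)) j) :=
  injectedRate_of_u3_by g gIR hW (fun _ _ hv => invSq_extd_mem_boxWindow ht₀ hv) h5 h9 hΛ hA hB hr hcov hcr hC₅ hθ
    hω hρ0 hθρ hωρ hρ1 (currencyWeight_invSq γ) zero_le_one hrun hbox hpin (by simpa using hsmall)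

/-! ### §5b The spine's own node-U3 bracket in the t-currency: node U2's native output IS the t-coupling rate (no γ³) -/

/-- Node U2's native output `InjectedRate Cd 0 θ (disc …)` IS the coupling rate IN THE t-CURRENCY of run A's re-indexed
t-history `i ↦ 1/(g K i)²` against run B's `i ↦ 1/(g (K+1) (i+1))²` — with constant `Cd` itself (contrast the g-currency seam
`T4TowerRateComposition.couplingRate_pair_of_injectedDisc`: constant `γ³·Cd`). [folklore] -/
theorem couplingRateT_of_injectedDisc {Cd θ : ℝ} {g : ℕ → ℕ → ℝ}
    (h : T4CauchySum.InjectedRate Cd 0 θ (fun K j => disc (g K) (g (K + 1)) j)) (K i : ℕ) (hi : i ≤ K) :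
    |(fun n => invSq (g K n)) i - (fun n => invSq (g (K + 1) (n + 1))) i| ≤ Cd * θ ^ i := by
  have h2 := (h K i hi).2
  simp only [pow_zero, mul_one] at h2
  simpa [invSq, disc, one_div] using h2

/-- **THE SPINE'S NODE U3 ALONG THE TOWER CONSUMES THE t-FORM TOO (kernel; `T4TowerRateComposition.uRateUpTo_tower` BY NAME,
which is parametrisation-agnostic).**  With EVERY node-U3 shape stated for term families of the t-HISTORY over a t-window
`Wt` — `NE9 Et Wt κ Λ` + `FadingMemory C₉ ω Λ`, `LipBackground Et Wt κ CU`, `NE5 Et EBt Wt κ θ C₅` — the two runs'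
re-indexed t-histories in `Wt`, node U2's NATIVE output `InjectedRate Cd 0 θ (disc (g K) (g (K+1)))`, the closeness of the
backgrounds and the composed argument bracket, one gets FOR EVERY CUTOFF `K` the node-U3 rate
`URateUpTo K Et EBt (t-run A) (t-run B) … (a + C₉·Cd·ω/(θ − ω) + C₅) θ κ` — the constant of the g-currency statement with
`γ³Cd` replaced by `Cd`.  So NEITHER consumer of NE9 (node U2: `injectedRate_of_ne9T`; node U3 along the tower: this
theorem) needs the g-form: on the analytic member wall W5 (GAPS G-ne9p1-8) is NOT load-bearing; [H-dil] + W2–W4 remain.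
Every hypothesis is an UNPRINTED cell shape (NE5/NE9/NE3-closeness/Lipschitz-in-U) or node U2's output; nothing of
[Balaban1987RG1] is asserted. [folklore] -/
theorem uRateUpTo_towerT {V : Type*} {Wt : Set (ℕ → ℝ)} {Et : Functional C C.BgA} {EBt : Functional C C.BgB}
    {κ θ C₅ C₉ ω Cd a : ℝ} {Λ : ℕ → ℕ → ℝ} {CU : (ℕ → ℝ) → ℕ → ℝ} (h9 : NE9 Et Wt κ Λ)
    (hΛ : T4OutputRate.FadingMemory C₉ ω Λ) (hU : LipBackground Et Wt κ CU) (h5 : NE5 Et EBt Wt κ θ C₅) (hω : 0 ≤ ω)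
    (hωθ : ω < θ) (hCd : 0 ≤ Cd) {g : ℕ → ℕ → ℝ} (htA : ∀ K, (fun n => invSq (g K n)) ∈ Wt)
    (htB : ∀ K, (fun n => invSq (g (K + 1) (n + 1))) ∈ Wt)
    (hinj : T4CauchySum.InjectedRate Cd 0 θ (fun K j => disc (g K) (g (K + 1)) j))
    {uA : ℕ → V → C.BgA} {uB : ℕ → V → C.BgB} {Adm : ℕ → Set V} {δc : ℕ → ℝ}
    (hclose : ∀ K, ∀ v ∈ Adm K, C.gauge (uA K v) (C.transport (uB K v)) ≤ δc K)
    (hCU : ∀ K j, j ≤ K → 0 ≤ CU (fun n => invSq (g K n)) j)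
    (harg : ∀ K j, j ≤ K → CU (fun n => invSq (g K n)) j * δc K ≤ a * θ ^ j) (K : ℕ) :
    URateUpTo K Et EBt (fun n => invSq (g K n)) (fun n => invSq (g (K + 1) (n + 1))) (uA K) (uB K) (Adm K)
      (a + C₉ * Cd * (ω / (θ - ω)) + C₅) θ κ :=
  uRateUpTo_tower (gA := fun K n => invSq (g K n)) (gB := fun K n => invSq (g (K + 1) (n + 1))) h9 hΛ hU h5 hω hωθ
    hCd htA htB (fun K i hi => couplingRateT_of_injectedDisc hinj K i hi) hclose hCU harg K

end Liaison

section Dilation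

variable {C : Carriers} {F : Type*} [NormedAddCommGroup F] [NormedSpace ℂ F] [CompleteSpace F]

/-- **END TO END ON THE ANALYTIC MEMBER (kernel composition, no new content): [H-dil]-shape hypotheses ⇒ node U2's output.**
The hypotheses of `T4CouplingAnalyticity.ne9T_of_dilationStep` at `t₀ ≤ γ⁻²` — (AN-LAST-dil) `s ↦ Φ j s w` analytic on the
RELATIVE discs `|z − s| ≤ c·s`, `s ≥ t₀`, with sup bound M₁; (AN-OLD) with M₂ on the ϱ-margin; (CONTR) with ω₀; coupling-free
scale 0; evaluation `ev` into the (0.25)-weighted carrier — ALL NOT PRINTED for Bałaban's step (`T4CouplingAnalyticity`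
docstring (L5), walls [H-dil]/W2–W4; GAPS G-ne9p1-2…-7, -6a) — together with NE5, the read-outs (R), the runs/box/pin, the
memory gap `μ := ω₀ + 4M₂/ϱ < ρ < 1` and the window `cr·(4M₁/(c·t₀))·ρ(ρ − μ)⁻¹ ≤ (1 − ρ)/2` give
`T4CauchySum.InjectedRate (2·cr·C₅·θ/(1−ρ)) 0 ρ (fun K j ↦ disc (g K) (g (K+1)) j)`.  The g-form of NE9 and wall W5
(GAPS G-ne9p1-8) do not occur.  Rung (B)+1 finite T⁴ bookkeeping; NOT summit progress. [folklore] -/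
theorem injectedRate_of_dilationStep {W : Set (ℕ → ℝ)} {Et : Functional C C.BgA} {EB : ℝ → Functional C C.BgB}
    {rA : ReadOut C C.BgA} {rB : ReadOut C C.BgB} {β : HBeta} {γ t₀ κ θ C₅ cr ρ c : ℝ}
    {V : ℕ → (ℕ → ℝ) → F} (T : ℕ → (ℕ → ℝ) → F) (Φ : ℕ → ℂ → F → F) (ev : F → C.BgA → C.Dom → ℝ)
    {M₁ M₂ ϱ ω₀ : ℝ} (g : ℕ → ℕ → ℝ) (gIR : ℝ)
    -- the analytic member's hypotheses (verbatim those of `T4CouplingAnalyticity.ne9T_of_dilationStep`)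
    (ht₀ : 0 < t₀) (hc : 0 < c) (hϱ : 0 < ϱ) (hM₁ : 0 ≤ M₁) (hM₂ : 0 ≤ M₂) (hω₀ : 0 ≤ ω₀)
    (hμ : 0 < ω₀ + 4 * M₂ / ϱ)
    (hev : ∀ (b b' : F) (U : C.BgA) (X : C.Dom), |ev b U X - ev b' U X| ≤ Real.exp (-(κ * C.d X)) * ‖b - b'‖)
    (hE : ∀ t ∈ BoxWindow (Set.Ici t₀), ∀ (U : C.BgA) (X : C.Dom), Et t U X = ev (V (C.scale X) t) U X)
    (h0 : ∀ t ∈ BoxWindow (Set.Ici t₀), ∀ t' ∈ BoxWindow (Set.Ici t₀), V 0 t = V 0 t')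
    (hV : ∀ j, ∀ t ∈ BoxWindow (Set.Ici t₀), V (j + 1) t = Φ j (t j : ℂ) (T j t))
    (hlast : ∀ j, ∀ t ∈ BoxWindow (Set.Ici t₀), ∃ D : Set ℂ, DifferentiableOn ℂ (fun s => Φ j s (T j t)) D ∧
      (∀ z ∈ D, ‖Φ j z (T j t)‖ ≤ M₁) ∧ ∀ s ∈ Set.Ici t₀, Metric.closedBall (s : ℂ) (c * s) ⊆ D)
    (hold : ∀ j, ∀ s ∈ Set.Ici t₀, ∃ D : Set F, DifferentiableOn ℂ (Φ j (s : ℂ)) D ∧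
      (∀ w ∈ D, ‖Φ j (s : ℂ) w‖ ≤ M₂) ∧ ∀ t ∈ BoxWindow (Set.Ici t₀), Metric.closedBall (T j t) ϱ ⊆ D)
    (hT : ∀ j, ∀ t ∈ BoxWindow (Set.Ici t₀), ∀ t' ∈ BoxWindow (Set.Ici t₀),
      ‖T j t - T j t'‖ ≤ ∑ m ∈ Finset.range (j + 1), ω₀ ^ (j - m) * ‖V m t - V m t'‖)
    -- the U2/U3-liaison side (verbatim the binders of `injectedRate_of_ne9T`)
    (hW : ∀ k (v : Fin (k + 1) → ℝ), v ∈ Box γ k → extd v ∈ W) (ht₀γ : t₀ ≤ (γ ^ 2)⁻¹)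
    (h5 : ∀ b, 0 < b → b ≤ γ → NE5 (reparam invSq Et) (EB b) W κ θ C₅)
    (hA : RepresentsA (reparam invSq Et) rA γ β) (hB : RepresentsB EB rB γ β) (hr : ReadBounded rA κ cr)
    (hcov : ReadCovariant rA rB κ cr) (hcr : 0 ≤ cr) (hC₅ : 0 ≤ C₅) (hθ : 0 ≤ θ) (hρ0 : 0 < ρ) (hθρ : θ ≤ ρ)
    (hμρ : ω₀ + 4 * M₂ / ϱ < ρ) (hρ1 : ρ < 1)
    (hrun : ∀ K, RGEqH K β (g K)) (hbox : ∀ K i, i ≤ K → 0 < g K i ∧ g K i ≤ γ) (hpin : ∀ K, g K K = gIR)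
    (hsmall : cr * (4 * M₁ / (c * t₀)) * (ρ / (ρ - (ω₀ + 4 * M₂ / ϱ))) ≤ (1 - ρ) / 2) :
    T4CauchySum.InjectedRate (2 * (cr * C₅ * θ) / (1 - ρ)) 0 ρ (fun K j => disc (g K) (g (K + 1)) j) := by
  obtain ⟨h9, hΛ⟩ := T4CouplingAnalyticity.ne9T_of_dilationStep (E := Et) T Φ ev ht₀ hc hϱ hM₁ hM₂ hω₀ hμ hev hE h0
    hV hlast hold hT
  have hsmall' : cr * (4 * M₁ / (c * t₀) / (ω₀ + 4 * M₂ / ϱ)) * (ω₀ + 4 * M₂ / ϱ)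
      * (ρ / (ρ - (ω₀ + 4 * M₂ / ϱ))) ≤ (1 - ρ) / 2 := by
    rwa [mul_assoc cr, div_mul_cancel₀ _ hμ.ne']
  exact injectedRate_of_ne9T g gIR hW ht₀γ h5 h9 hΛ hA hB hr hcov hcr hC₅ hθ hμ.le hρ0 hθρ hμρ hρ1 hrun hbox hpin
    hsmall'

end Dilation

/-! ## §6 Non-vacuity -/

/-- The shapes of §1 are inhabited by the constant family: `ScaleShiftRate 0 θ`, `HistLipschitzBy φ 0`. [folklore] -/
theorem shapes_const (φ : ℝ → ℝ) (b θ γ : ℝ) :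
    ScaleShiftRate 0 θ γ (fun _ _ => b) ∧ HistLipschitzBy φ (fun _ _ => 0) γ (fun _ _ => b) := by
  refine ⟨fun k w _ => by simp, fun k p q _ _ => by simp⟩

/-- The hypothesis set of `twoSided_fixedPoint_rateLoss` is consistent with a non-trivial conclusion: the pure-source
profile `δ_j = c·Σ_{i∈[j,K)} ρ^i` satisfies it (with C = 0) and the bound `2c(1−ρ)⁻¹ρ^j` is attained up to the factor 2.
[folklore] -/
theorem rateLoss_window_example {ρ c : ℝ} (hρ0 : 0 < ρ) (hρ1 : ρ < 1) (hc : 0 ≤ c) (K : ℕ) :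
    ∀ j, j ≤ K → (fun j => c * ∑ i ∈ Ico j K, ρ ^ i) j ≤ 2 * c / (1 - ρ) * ρ ^ j := by
  refine twoSided_fixedPoint_rateLoss (u := fun _ => 0) (ubar := 0) (θ := ρ) (ω := 0) (C := 0) hρ0 hρ1 hρ0.le
    le_rfl le_rfl hρ0 hc le_rfl (fun j => ?_) (fun _ _ => ⟨le_rfl, le_rfl⟩) (by simp; linarith) (by simp) ?_
  · exact mul_nonneg hc (Finset.sum_nonneg fun i _ => pow_nonneg hρ0.le i)
  · intro j hj
    simp only [zero_mul, mul_zero, Finset.sum_const_zero, add_zero]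
    rw [Finset.sum_eq_sum_Ico_succ_bot hj, mul_add]
    linarith

end Literature.MathematicalPhysics.QuantumFieldTheory.Balaban1983to89.T4CurrencyMatching
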